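import Literature.MathematicalPhysics.QuantumLattice.HubbardCouplingWeights
import HarnessLib

/-!
# Connected bond sets through a vertex: components and the binary decomposition at a bond

HONEST FRAMING (cell pub-hubbard): ladder R1–R4 with certified numbers; no claim on H/H₀. This file
proves bounds for model classes (polymer combinatorics / activities of Hubbard-type lattice fermions),
no materials claim. LEAN FILING REQUEST #195 part 1 of 5 (bounds g25); generic, imports only the tree.

For directed spin-bonds `b = (x, y, σ)` (`Bond Λ`, vertex sets `verts b = {x, y}`) and a finite bond set
`X`, `vcomp X v` is the `ShareVertex`-component of `X` through the vertex `v` (the tree's `rcomponent`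
of any bond of `X` at `v`; `∅` if no bond of `X` passes through `v`). For a `ShareVertex`-connected `X`
and a bond `b₀ ∈ X` through `v` with other endpoint `u = otherEnd v b₀`:

* `erase_subset_vcomp_union`: `X \ {b₀} ⊆ vcomp (X \ {b₀}) v ∪ vcomp (X \ {b₀}) u`;
* `eq_insert_vcomp_union_piece₂`: `X = {b₀} ⊔ X₁ ⊔ X₂` with `X₁ = vcomp (X \ {b₀}) v` and
  `X₂ = piece₂ X b₀ v` (the component through `u`, replaced by `∅` when it coincides with `X₁`);
* `prod_eq_mul_prod_prod`: `∏_{b ∈ X} w_b = w_{b₀} · ∏_{X₁} w · ∏_{X₂} w`;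
* `card_cellSupp_le_add`: `|supp X| ≤ |{v} ∪ supp X₁| + |{u} ∪ supp X₂|`.

This is the combinatorial input of the Catalan recursion for the entropy of connected bond sets
(`ConnectedBondSetEntropy`, part 2) used in the high-temperature Kotecký–Preiss bound of
bounds.tex §12 (Lemma 12.4). [folklore]

Tree search: `rcomponent`, `isRConnected_rcomponent`, `rcomponent_eq_of_mem`, `mem_rcomponent*`
(`PolymerGasGeometric`); `cellSupp`, `ShareVertex`, `connectedCellSets` (`PolymerPushforward`);
`Bond.verts` (`HubbardBondAlgebra`). No tree lemma decomposes a connected cell set at a cell.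

References: R. Kotecký, D. Preiss, Comm. Math. Phys. 103 (1986) 491 [KoteckyPreiss1986];
D. Ueltschi, J. Stat. Phys. 95 (1999) 693, §2.3 [Ueltschi1999].
-/

noncomputable section

namespace Summit.HubbardSuperconductivity.HubbardLadder.Bounds

open Finset Literature.Probability.LatticeModels Literature.MathematicalPhysics.QuantumLattice

variable {Λ : Type*} [DecidableEq Λ]

/-! ### The other endpoint of a bond -/

/-- The endpoint of the bond `b = (x, y, σ)` other than `v`: `y` if `v = x`, else `x`. [folklore] -/
def otherEnd (v : Λ) (b : Bond Λ) : Λ := if b.1 = v then b.2.1 else b.1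

omit [DecidableEq Λ] in
/-- Auxiliary lemma `mem_verts_iff` (support step for the results of this file; see the module docstring). -/
theorem mem_verts_iff [DecidableEq Λ] {v : Λ} {b : Bond Λ} : v ∈ Bond.verts b ↔ v = b.1 ∨ v = b.2.1 := by
  simp [Bond.verts]

/-- Auxiliary lemma `verts_eq_pair` (support step for the results of this file; see the module docstring). -/
theorem verts_eq_pair {v : Λ} {b : Bond Λ} (hv : v ∈ Bond.verts b) :
    Bond.verts b = {v, otherEnd v b} := by
  rcases mem_verts_iff.1 hv with rfl | rfl
  · simp [Bond.verts, otherEnd]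
  · by_cases h : b.1 = b.2.1
    · simp [Bond.verts, otherEnd, h]
    · simp [Bond.verts, otherEnd, h, Finset.pair_comm]

/-! ### The component of a bond set through a vertex -/

/-- The `ShareVertex`-component of the bond set `X` through the vertex `v`: the bonds of `X` joined
inside `X` to a bond containing `v` (`∅` if no bond of `X` contains `v`). [folklore] -/
def vcomp (X : Finset (Bond Λ)) (v : Λ) : Finset (Bond Λ) :=
  by classical exact
    if h : ∃ b ∈ X, v ∈ Bond.verts b then rcomponent (ShareVertex Bond.verts) X h.choose else ∅

/-- Auxiliary lemma `shareVertex_symm'` (support step for the results of this file; see the module docstring). -/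
theorem shareVertex_symm' : ∀ b b' : Bond Λ, ShareVertex Bond.verts b b' → ShareVertex Bond.verts b' b :=
  fun b b' h => shareVertex_symm b b' h

/-- Auxiliary lemma `shareVertex_of_mem` (support step for the results of this file; see the module docstring). -/
theorem shareVertex_of_mem {v : Λ} {b b' : Bond Λ} (h : v ∈ Bond.verts b) (h' : v ∈ Bond.verts b') :
    ShareVertex Bond.verts b b' :=
  ⟨v, Finset.mem_inter.2 ⟨h, h'⟩⟩

/-- Auxiliary lemma `vcomp_of_exists` (support step for the results of this file; see the module docstring). -/
theorem vcomp_of_exists {X : Finset (Bond Λ)} {v : Λ} (h : ∃ b ∈ X, v ∈ Bond.verts b) :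
    vcomp X v = rcomponent (ShareVertex Bond.verts) X h.choose := by
  classical
  unfold vcomp
  rw [dif_pos h]

/-- Auxiliary lemma `vcomp_of_not_exists` (support step for the results of this file; see the module docstring). -/
theorem vcomp_of_not_exists {X : Finset (Bond Λ)} {v : Λ} (h : ¬ ∃ b ∈ X, v ∈ Bond.verts b) :
    vcomp X v = ∅ := by
  classical
  unfold vcomp
  rw [dif_neg h]

/-- Auxiliary lemma `vcomp_subset` (support step for the results of this file; see the module docstring). -/
theorem vcomp_subset (X : Finset (Bond Λ)) (v : Λ) : vcomp X v ⊆ X := by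
  by_cases h : ∃ b ∈ X, v ∈ Bond.verts b
  · rw [vcomp_of_exists h]; exact rcomponent_subset _ _
  · rw [vcomp_of_not_exists h]; exact Finset.empty_subset _

/-- The component through `v` is the component of ANY bond of `X` containing `v`. [folklore] -/
theorem vcomp_eq_rcomponent {X : Finset (Bond Λ)} {v : Λ} {b : Bond Λ} (hb : b ∈ X) (hv : v ∈ Bond.verts b) :
    vcomp X v = rcomponent (ShareVertex Bond.verts) X b := by
  have h : ∃ b ∈ X, v ∈ Bond.verts b := ⟨b, hb, hv⟩
  rw [vcomp_of_exists h]
  obtain ⟨hb', hv'⟩ := h.choose_spec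
  -- `b` lies in the component of `h.choose` (one step through `v`)
  have hmem : b ∈ rcomponent (ShareVertex Bond.verts) X h.choose :=
    mem_rcomponent.2 ⟨hb, Relation.ReflTransGen.single ⟨shareVertex_of_mem hv' hv, hb', hb⟩⟩
  exact (rcomponent_eq_of_mem shareVertex_symm' hmem).symm

/-- Auxiliary lemma `mem_vcomp_of_mem_rcomponent` (support step for the results of this file; see the module docstring). -/
theorem mem_vcomp_of_mem_rcomponent {X : Finset (Bond Λ)} {v : Λ} {b q : Bond Λ} (hb : b ∈ X)
    (hv : v ∈ Bond.verts b) (hq : q ∈ rcomponent (ShareVertex Bond.verts) X b) : q ∈ vcomp X v := by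
  rwa [vcomp_eq_rcomponent hb hv]

/-- Auxiliary lemma `mem_vcomp_self` (support step for the results of this file; see the module docstring). -/
theorem mem_vcomp_self {X : Finset (Bond Λ)} {v : Λ} {b : Bond Λ} (hb : b ∈ X) (hv : v ∈ Bond.verts b) :
    b ∈ vcomp X v :=
  mem_vcomp_of_mem_rcomponent hb hv (mem_rcomponent_self hb)

/-- Components are closed under `ShareVertex`-steps inside `X`. [folklore] -/
theorem mem_vcomp_of_shareVertex {X : Finset (Bond Λ)} {v : Λ} {p q : Bond Λ} (hp : p ∈ vcomp X v)
    (hq : q ∈ X) (hpq : ShareVertex Bond.verts p q) : q ∈ vcomp X v := by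
  by_cases h : ∃ b ∈ X, v ∈ Bond.verts b
  · rw [vcomp_of_exists h] at hp ⊢
    obtain ⟨hpX, hrt⟩ := mem_rcomponent.1 hp
    exact mem_rcomponent.2 ⟨hq, hrt.tail ⟨hpq, hpX, hq⟩⟩
  · rw [vcomp_of_not_exists h] at hp; exact absurd hp (Finset.notMem_empty _)

/-- A component through `v` is empty, or connected with `v` in its support. [folklore] -/
theorem vcomp_eq_empty_or (X : Finset (Bond Λ)) (v : Λ) :
    vcomp X v = ∅ ∨ (IsRConnected (ShareVertex Bond.verts) (vcomp X v) ∧ v ∈ cellSupp Bond.verts (vcomp X v)) := by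
  by_cases h : ∃ b ∈ X, v ∈ Bond.verts b
  · right
    obtain ⟨hb, hv⟩ := h.choose_spec
    refine ⟨?_, mem_cellSupp.2 ⟨h.choose, mem_vcomp_self hb hv, hv⟩⟩
    rw [vcomp_of_exists h]
    exact isRConnected_rcomponent shareVertex_symm' hb
  · exact Or.inl (vcomp_of_not_exists h)

/-- Two components through vertices are equal or disjoint. [folklore] -/
theorem vcomp_eq_or_disjoint (X : Finset (Bond Λ)) (v u : Λ) :
    vcomp X u = vcomp X v ∨ Disjoint (vcomp X v) (vcomp X u) := by
  by_cases hv : ∃ b ∈ X, v ∈ Bond.verts b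
  · by_cases hu : ∃ b ∈ X, u ∈ Bond.verts b
    · rw [vcomp_of_exists hv, vcomp_of_exists hu]
      by_cases hd : Disjoint (rcomponent (ShareVertex Bond.verts) X hv.choose)
          (rcomponent (ShareVertex Bond.verts) X hu.choose)
      · exact Or.inr hd
      · left
        obtain ⟨q, hqv, hqu⟩ := Finset.not_disjoint_iff.1 hd
        rw [← rcomponent_eq_of_mem shareVertex_symm' hqv, ← rcomponent_eq_of_mem shareVertex_symm' hqu]
    · rw [vcomp_of_not_exists hu]; exact Or.inr (Finset.disjoint_empty_right _)
  · rw [vcomp_of_not_exists hv]; exact Or.inr (Finset.disjoint_empty_left _)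

/-- **Removing a bond**: the rest of a connected bond set is covered by the components through the
two endpoints of the removed bond. [folklore] -/
theorem erase_subset_vcomp_union {X : Finset (Bond Λ)} (hX : IsRConnected (ShareVertex Bond.verts) X)
    {b₀ : Bond Λ} (hb₀ : b₀ ∈ X) :
    X.erase b₀ ⊆ vcomp (X.erase b₀) b₀.1 ∪ vcomp (X.erase b₀) b₀.2.1 := by
  set X' := X.erase b₀ with hX'
  -- every bond reachable from `b₀` inside `X` is `b₀` or in one of the two components
  have key : ∀ q, Relation.ReflTransGen (fun x y => ShareVertex Bond.verts x y ∧ x ∈ X ∧ y ∈ X) b₀ q →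
      q = b₀ ∨ q ∈ vcomp X' b₀.1 ∪ vcomp X' b₀.2.1 := by
    intro q h
    induction h with
    | refl => exact Or.inl rfl
    | @tail p q _ hpq ih =>
      obtain ⟨hsv, -, hqX⟩ := hpq
      by_cases hq : q = b₀
      · exact Or.inl hq
      · right
        have hqX' : q ∈ X' := Finset.mem_erase.2 ⟨hq, hqX⟩
        rcases ih with rfl | hp
        · -- one step from `b₀`: the shared vertex is an endpoint of `b₀`
          obtain ⟨z, hz⟩ := hsv
          obtain ⟨hz₀, hzq⟩ := Finset.mem_inter.1 hz
          rcases mem_verts_iff.1 hz₀ with rfl | rfl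
          · exact Finset.mem_union_left _ (mem_vcomp_self hqX' hzq)
          · exact Finset.mem_union_right _ (mem_vcomp_self hqX' hzq)
        · rcases Finset.mem_union.1 hp with hp | hp
          · exact Finset.mem_union_left _ (mem_vcomp_of_shareVertex hp hqX' hsv)
          · exact Finset.mem_union_right _ (mem_vcomp_of_shareVertex hp hqX' hsv)
  intro q hq
  obtain ⟨hqb, hqX⟩ := Finset.mem_erase.1 hq
  rcases key q (hX.2 b₀ hb₀ q hqX) with h | h
  · exact absurd h hqb
  · exact h


/-- Auxiliary lemma `erase_subset_vcomp_union'` (support step for the results of this file; see the module docstring). -/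
theorem erase_subset_vcomp_union' {X : Finset (Bond Λ)} (hX : IsRConnected (ShareVertex Bond.verts) X)
    {b₀ : Bond Λ} (hb₀ : b₀ ∈ X) {v : Λ} (hv : v ∈ Bond.verts b₀) :
    X.erase b₀ ⊆ vcomp (X.erase b₀) v ∪ vcomp (X.erase b₀) (otherEnd v b₀) := by
  have h := erase_subset_vcomp_union hX hb₀
  by_cases h1 : b₀.1 = v
  · rw [otherEnd, if_pos h1, ← h1]; exact h
  · have h2 : v = b₀.2.1 := by
      rcases mem_verts_iff.1 hv with h' | h'
      · exact absurd h'.symm h1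
      · exact h'
    rw [otherEnd, if_neg h1, h2, Finset.union_comm]; exact h

/-! ### The binary decomposition at a bond through `v` -/

/-- The second piece: the component of `X ∖ b₀` through the other endpoint `u` of `b₀`, unless it
coincides with the component through `v` (then `∅`). [folklore] -/
def piece₂ (X : Finset (Bond Λ)) (b₀ : Bond Λ) (v : Λ) : Finset (Bond Λ) :=
  if vcomp (X.erase b₀) (otherEnd v b₀) = vcomp (X.erase b₀) v then ∅ else vcomp (X.erase b₀) (otherEnd v b₀)

/-- Auxiliary lemma `piece₂_subset` (support step for the results of this file; see the module docstring). -/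
theorem piece₂_subset (X : Finset (Bond Λ)) (b₀ : Bond Λ) (v : Λ) : piece₂ X b₀ v ⊆ X.erase b₀ := by
  unfold piece₂; split_ifs
  · exact Finset.empty_subset _
  · exact vcomp_subset _ _

/-- Auxiliary lemma `piece₂_eq_empty_or` (support step for the results of this file; see the module docstring). -/
theorem piece₂_eq_empty_or (X : Finset (Bond Λ)) (b₀ : Bond Λ) (v : Λ) :
    piece₂ X b₀ v = ∅ ∨ (IsRConnected (ShareVertex Bond.verts) (piece₂ X b₀ v) ∧
      otherEnd v b₀ ∈ cellSupp Bond.verts (piece₂ X b₀ v)) := by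
  unfold piece₂; split_ifs
  · exact Or.inl rfl
  · exact vcomp_eq_empty_or _ _

/-- Auxiliary lemma `disjoint_vcomp_piece₂` (support step for the results of this file; see the module docstring). -/
theorem disjoint_vcomp_piece₂ (X : Finset (Bond Λ)) (b₀ : Bond Λ) (v : Λ) :
    Disjoint (vcomp (X.erase b₀) v) (piece₂ X b₀ v) := by
  unfold piece₂; split_ifs with h
  · exact Finset.disjoint_empty_right _
  · rcases vcomp_eq_or_disjoint (X.erase b₀) v (otherEnd v b₀) with h' | h'
    · exact absurd h' h
    · exact h'

/-- Auxiliary lemma `notMem_vcomp_union_piece₂` (support step for the results of this file; see the module docstring). -/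
theorem notMem_vcomp_union_piece₂ (X : Finset (Bond Λ)) (b₀ : Bond Λ) (v : Λ) :
    b₀ ∉ vcomp (X.erase b₀) v ∪ piece₂ X b₀ v := by
  intro h
  rcases Finset.mem_union.1 h with h | h
  · exact Finset.notMem_erase b₀ X (vcomp_subset _ _ h)
  · exact Finset.notMem_erase b₀ X (piece₂_subset _ _ _ h)

/-- **The decomposition** `X = {b₀} ⊔ X₁ ⊔ X₂`. [folklore] -/
theorem eq_insert_vcomp_union_piece₂ {X : Finset (Bond Λ)} (hX : IsRConnected (ShareVertex Bond.verts) X)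
    {b₀ : Bond Λ} (hb₀ : b₀ ∈ X) {v : Λ} (hv : v ∈ Bond.verts b₀) :
    X = insert b₀ (vcomp (X.erase b₀) v ∪ piece₂ X b₀ v) := by
  ext q
  constructor
  · intro hq
    by_cases hqb : q = b₀
    · rw [hqb]; exact Finset.mem_insert_self _ _
    · refine Finset.mem_insert_of_mem ?_
      have hq' := erase_subset_vcomp_union' hX hb₀ hv (Finset.mem_erase.2 ⟨hqb, hq⟩)
      rcases Finset.mem_union.1 hq' with h | h
      · exact Finset.mem_union_left _ h
      · unfold piece₂
        split_ifs with he
        · rw [he] at h; exact Finset.mem_union_left _ h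
        · exact Finset.mem_union_right _ h
  · intro hq
    rcases Finset.mem_insert.1 hq with rfl | hq
    · exact hb₀
    · rcases Finset.mem_union.1 hq with h | h
      · exact Finset.mem_of_mem_erase (vcomp_subset _ _ h)
      · exact Finset.mem_of_mem_erase (piece₂_subset _ _ _ h)

/-- The weight factorises over the decomposition. [folklore] -/
theorem prod_eq_mul_prod_prod (w : Bond Λ → ℝ) {X : Finset (Bond Λ)} (hX : IsRConnected (ShareVertex Bond.verts) X)
    {b₀ : Bond Λ} (hb₀ : b₀ ∈ X) {v : Λ} (hv : v ∈ Bond.verts b₀) :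
    ∏ b ∈ X, w b = w b₀ * ((∏ b ∈ vcomp (X.erase b₀) v, w b) * ∏ b ∈ piece₂ X b₀ v, w b) := by
  conv_lhs => rw [eq_insert_vcomp_union_piece₂ hX hb₀ hv]
  rw [Finset.prod_insert (notMem_vcomp_union_piece₂ X b₀ v), Finset.prod_union (disjoint_vcomp_piece₂ X b₀ v)]

/-- The support is covered by `{v} ∪ supp X₁` and `{u} ∪ supp X₂`. [folklore] -/
theorem card_cellSupp_le_add {X : Finset (Bond Λ)} (hX : IsRConnected (ShareVertex Bond.verts) X)
    {b₀ : Bond Λ} (hb₀ : b₀ ∈ X) {v : Λ} (hv : v ∈ Bond.verts b₀) :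
    (cellSupp Bond.verts X).card ≤
      (insert v (cellSupp Bond.verts (vcomp (X.erase b₀) v))).card +
        (insert (otherEnd v b₀) (cellSupp Bond.verts (piece₂ X b₀ v))).card := by
  refine (Finset.card_le_card ?_).trans (Finset.card_union_le _ _)
  intro z hz
  obtain ⟨b, hb, hzb⟩ := mem_cellSupp.1 hz
  rw [eq_insert_vcomp_union_piece₂ hX hb₀ hv] at hb
  rcases Finset.mem_insert.1 hb with rfl | hb
  · rw [verts_eq_pair hv] at hzb
    rcases Finset.mem_insert.1 hzb with rfl | hzb
    · exact Finset.mem_union_left _ (Finset.mem_insert_self _ _)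
    · rw [Finset.mem_singleton] at hzb
      rw [hzb]; exact Finset.mem_union_right _ (Finset.mem_insert_self _ _)
  · rcases Finset.mem_union.1 hb with hb | hb
    · exact Finset.mem_union_left _ (Finset.mem_insert_of_mem (mem_cellSupp.2 ⟨b, hb, hzb⟩))
    · exact Finset.mem_union_right _ (Finset.mem_insert_of_mem (mem_cellSupp.2 ⟨b, hb, hzb⟩))

end Summit.HubbardSuperconductivity.HubbardLadder.Bounds

end
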